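import Literature.NumberTheory.ComplexMultiplication.EllipticUnits.ImaginaryQuadraticMainConjectureCarriersLevels
import Literature.NumberTheory.EllipticCurves.IwasawaLayerModuleTwoVarLinear
import HarnessLib

/-!
# The pinned carriers `H^i(𝒪_K[1/p𝔣], Λ(χ)(1)) = lim←_{n,k} H^i(G_S(K̃_n), μ_{p^k} ⊗ θ)` of
# Johnson-Leung–Kings 2011 (Def. 4.2 (94), Cor. 5.3): THE PINS DETERMINE THE `Λ`-ACTION, the
# UNIVERSAL PROPERTY (`Λ`-linear maps into the carrier = compatible families of level maps), and
# UNIQUENESS of the pinned datum up to isomorphism — proved, no named fact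

Topic `Literature/NumberTheory/ComplexMultiplication/EllipticUnits` (grouping sub-namespace
`JohnsonLeungKings2011`); companion of `ImaginaryQuadraticMainConjectureCarriers.lean` (seat
`bsd-print-cf2-ty2` g37: the hypothesis structure `IwasawaCohomologyData p κ₁ κ₂ γ₁ γ₂ θ 𝔣 i` with
its pins (P1)–(P8)) and of `ImaginaryQuadraticMainConjectureCarriersLevels.lean` (seat `bsd-line-cf2-p1-w5` g9: the level
structure — uniform `p^k`-torsion, the conjugation operators, `isLocNil₂_layerConjEnd`; its sequel
`…CarriersGroupElt.lean` treats the `p`-adic powers `(1+T₁)^{x₁}(1+T₂)^{x₂}`). Cell `bsd-print-cf2` (`run/shared/lean/pub/bsd-print-cf2/`), width seat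
`bsd-line-cf2c-w8` g8 (prover); consumer: the two ROWS of the (α3) kernel descent on the deciding
child `PrintCf2RubinValueTwo.MainConjClauseAtSplitTwoQuadDA` (stmt-BirchSwinnertonDyer-24721), which
must produce `Λ₂`-LINEAR maps `C.X → D2.H` (class-group side, Poitou–Tate at the layers) and
`E.Q → D1.H` (units side, Kummer at the layers) into the pinned carriers of an ARBITRARY datum
`D : TwistedIwasawaData …` (the named fact `cor53_thm52Shape` quantifies over all data).
THEOREMS ONLY; no definition, no named fact, no `instance`, no `sorry`.

WHAT. Transcription note (T2) of the carriers file says: "these pins DETERMINE the datum up to a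
unique isomorphism compatible with all projections (every level is killed by
`(p^k, (1+T_i)^{p^n} − 1)` …), so a `∀`-fact over the data is a statement about ONE object", and the
docstring of `IwasawaCohomologyData`: "(P8) (CONTINUITY) … so that `Λ₂` acts on the FINITE levels
through finite quotient rings and (P5)–(P7) determine the action of every power series". This file
PROVES both sentences, for the degrees `i ≤ 2` of the structure (where inner automorphisms of the
level groups act trivially, `levelConj_eq_self_of_mem`):

* §1 `layerConjEnd_sub_one_pow_apply_eq_zero`: on the layer `(n, k)` the operator `conj_γ − 1` is
  nilpotent of the UNIFORM exponent `k·p^{n+k}` for EVERY `γ ∈ Γ_K` (`γ^{pⁿ} ∈ Gal(K̄/K̃_n)` acts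
  trivially, the layer is killed by `p^k`; the tree's `pow_twistEnd_sub_one_apply_eq_zero` at `u = 1`).
* §2 `map_smul_of_pins`: an additive map from ANY `Λ₂`-module into a layer group satisfying the three
  pin-shaped equations (`T₁ ↦ conj_{γ₁} − 1`, `T₂ ↦ conj_{γ₂} − 1`, constants `c ∈ ℤ_p` through
  `ℤ_p → ℤ/p^k`) is `Λ₂`-linear for the `IsLocNil₂.selfModule` structure of the layer (the tree's
  `IsLocNil₂.map_smul_of_commute` with §1); hence **`IwasawaCohomologyData.proj_smul`**:
  `I.proj n k (F • x) = F • I.proj n k x` for EVERY `F ∈ Λ₂` — (P5)–(P7) determine the action, (P8) is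
  a consequence —, and the level ideal `(p^k, (1+T₁)^{pⁿ} − 1, (1+T₂)^{pⁿ} − 1)` maps `H` into
  `ker (proj n k)` (`proj_one_add_X_pow_prime_pow_smul`, `proj_smul_eq_zero_of_mem_span`; the `p`-adic powers
  `(1+T₁)^{x₁}(1+T₂)^{x₂}` are `bsd-line-cf2-p1-w5` g9's `ImaginaryQuadraticMainConjectureCarriersGroupElt.lean`).
* §3 **the universal property** `IwasawaCohomologyData.exists_linearMap_of_levelMaps`: from any
  `Λ₂`-module `X` and additive level maps `f n k : X →+ H^i(G_S(K̃_n), μ_{p^k} ⊗ θ)` compatible with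
  the corestrictions and the reductions and satisfying the three pin-shaped equations there is a
  `Λ₂`-LINEAR `Φ : X →ₗ[Λ₂] I.H` with `I.proj n k (Φ x) = f n k x`, unique (`eq_of_forall_proj_eq`),
  with `Φ x = 0 ↔ ∀ n k, f n k x = 0` (`map_eq_zero_iff_of_proj_eq`) and the tautological description
  of its range (`mem_range_iff_of_proj_eq`) — the form in which ROW 1 / ROW 2 obtain their maps;
* §4 **uniqueness of the pinned datum** `IwasawaCohomologyData.exists_linearEquiv_proj_eq`: any two
  data `I, I'` (same `K, p, κ_i, γ_i, θ, 𝔣, i ≤ 2`) are isomorphic as `Λ₂`-modules compatibly with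
  all projections (note (T2) as a theorem), so `cor53_thm52Shape`, a `∀` over data, speaks about one
  object as soon as one datum exists (the cell's construction F0a).

NO hypothesis on `K`, on `(γ₁, γ₂)` (no generator condition), on `θ` or `𝔣` is used.
HONEST FRAMING: module-theoretic bookkeeping over the pins; no arithmetic duality, no case of the main
conjecture and no case of BSD is proved here; no summit statement is proved by this seat.

## References
* [JohnsonLeungKings2011] J. Johnson-Leung, G. Kings, J. reine angew. Math. 653 (2011) 75–114 =
  arXiv:0804.2828: §4.1 Def. 4.1, §4.2 Def. 4.2 (94) and the sentence on the `Λ_𝒪`-module structure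
  (p0012:L7–47, L80–112); Cor. 5.3 (p0015:L1–20).
* [Kato2004Asterisque] K. Kato, Astérisque 295 (2004), §8.2 (p. 180) ("`H^q(R,T) = lim←_n H^q(R,T/pⁿ)`"),
  §12.2 (12.2.1) (p. 220).
* [Lang1990] S. Lang, *Cyclotomic Fields I and II*, GTM 121, Ch. 5 §1 (Thm. 1.1: `Λ = lim 𝔬[X]/((1+X)^{pⁿ} − 1)`,
  operations of `Λ` on inverse limits through the finite quotients).
* [NeukirchSchmidtWingberg2008] (5.3.5) (`ℤ_p⟦ℤ_p²⟧ ≅ ℤ_p⟦T₁,T₂⟧`); [SerreLocalFields1979] VII §5 Prop. 3.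
-/

noncomputable section

open scoped NumberField
open Field IsDedekindDomain PowerSeries
open Literature.NumberTheory.GaloisRepresentations
open Literature.NumberTheory.EllipticCurves Literature.NumberTheory.EllipticCurves.IwasawaDual

namespace Literature.NumberTheory.ComplexMultiplication.EllipticUnits.JohnsonLeungKings2011

/-! ## §1 Uniform nilpotence of `conj_γ − 1` on a layer group -/

section Uniform

variable {K : Type} [Field K] [NumberField K] (p : ℕ) [Fact p.Prime]
  (κ₁ κ₂ : ZpExtension K p) (θ : absoluteGaloisGroup K →ₜ* ℤ_[p]ˣ) (𝔣 : Ideal (𝓞 K))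

omit [NumberField K] in
/-- Unfolding the operator `conj_γ − 1` of a layer group: `(conj_γ − 1) c = γ·c − c`.
[cite: JohnsonLeungKings2011, §4.2 (arXiv p0012:L109–112)] -/
theorem layerConjEnd_sub_one_apply (n k i : ℕ) (γ : absoluteGaloisGroup K) (c : layerCoh p κ₁ κ₂ θ 𝔣 n k i) :
    (layerConjEnd p κ₁ κ₂ θ 𝔣 n k i γ - 1) c = layerConj p κ₁ κ₂ θ 𝔣 n k i γ c - c := rfl

/-- **UNIFORM nilpotence of `conj_γ − 1` on the layer `H^i(G_S(K̃_n), μ_{p^k} ⊗ θ)`, `i ≤ 2`**: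
`(conj_γ − 1)^{k·p^{n+k}} = 0` for EVERY `γ ∈ Γ_K` (`γ^{pⁿ} ∈ Gal(K̄/K̃_n)` acts trivially and the layer is
killed by `p^k`; the tree's `pow_twistEnd_sub_one_apply_eq_zero` with the trivial twist `u = 1`). This is
the uniformity that lets `Λ₂ = lim ℤ_p[T₁,T₂]/(p^k, T₁^N, T₂^N)` act on the layer through ONE finite quotient.
[cite: Lang1990, Ch. 5 §1 (Thm. 1.1)] [cite: JohnsonLeungKings2011, §4.2 (arXiv p0012:L109–112)] -/
theorem layerConjEnd_sub_one_pow_apply_eq_zero (n k : ℕ) {i : ℕ} (hi : i ≤ 2) (γ : absoluteGaloisGroup K)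
    (c : layerCoh p κ₁ κ₂ θ 𝔣 n k i) :
    ((layerConjEnd p κ₁ κ₂ θ 𝔣 n k i γ - 1) ^ (k * p ^ (n + k))) c = 0 := by
  have h := pow_twistEnd_sub_one_apply_eq_zero (p := p) (n := 1) (e := k) (m := n)
    (layerConjEnd p κ₁ κ₂ θ 𝔣 n k i γ)
    (fun a ↦ layerConjEnd_pow_apply_eq_self p κ₁ κ₂ θ 𝔣 n k hi γ a)
    (fun a ↦ levelCoh_torsion p (suppPF p 𝔣) θ (isOpen_pairLayerSubgroup κ₁ κ₂ n) k i a)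
    (by rw [Nat.cast_one, sub_self]; exact dvd_zero _) c
  rwa [twistEnd_one] at h

end Uniform

/-! ## §2 The pins determine the `Λ₂`-action on every layer -/

section LevelLinear

variable {K : Type} [Field K] [NumberField K] (p : ℕ) [Fact p.Prime]
  (κ₁ κ₂ : ZpExtension K p) (γ₁ γ₂ : absoluteGaloisGroup K)
  (θ : absoluteGaloisGroup K →ₜ* ℤ_[p]ˣ) (𝔣 : Ideal (𝓞 K))

/-- **An additive map from ANY `Λ₂`-module into a layer group satisfying the three pin-shaped equations
is `Λ₂`-linear** for the layer's `IsLocNil₂.selfModule` structure (`T_i ↦ conj_{γ_i} − 1`): if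
`τ (T₁ • x) = γ₁·τ x − τ x`, `τ (T₂ • x) = γ₂·τ x − τ x` and `τ (c • x) = (c mod p^k) • τ x` for the
constants `c ∈ ℤ_p`, then `τ (F • x) = F • τ x` for EVERY `F ∈ Λ₂ = ℤ_p⟦T₂⟧⟦T₁⟧` (the tree's
`IsLocNil₂.map_smul_of_commute`, whose uniformity hypotheses are §1 and `levelCoh_torsion`).
[cite: Lang1990, Ch. 5 §1 (Thm. 1.1)] [cite: JohnsonLeungKings2011, §4.2 (arXiv p0012:L109–112)] -/
theorem map_smul_of_pins (n k : ℕ) {i : ℕ} (hi : i ≤ 2) {X : Type*} [AddCommGroup X]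
    [Module (IwasawaAlgebra₂ p) X] (τ : X →+ layerCoh p κ₁ κ₂ θ 𝔣 n k i)
    (h₁ : ∀ x : X, τ ((PowerSeries.X : IwasawaAlgebra₂ p) • x) =
      layerConj p κ₁ κ₂ θ 𝔣 n k i γ₁ (τ x) - τ x)
    (h₂ : ∀ x : X, τ ((PowerSeries.C (PowerSeries.X : IwasawaAlgebra p) : IwasawaAlgebra₂ p) • x) =
      layerConj p κ₁ κ₂ θ 𝔣 n k i γ₂ (τ x) - τ x)
    (h₃ : ∀ (c : ℤ_[p]) (x : X),
      τ ((PowerSeries.C (PowerSeries.C c : IwasawaAlgebra p) : IwasawaAlgebra₂ p) • x) =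
        ((PadicInt.toZModPow k c).val : ℤ) • τ x)
    (F : IwasawaAlgebra₂ p) (x : X) :
    τ (F • x) = (letI := (isLocNil₂_layerConjEnd p κ₁ κ₂ γ₁ γ₂ θ 𝔣 n k hi).selfModule; F • τ x) :=
  (isLocNil₂_layerConjEnd p κ₁ κ₂ γ₁ γ₂ θ 𝔣 n k hi).map_smul_of_commute (N := k * p ^ (n + k)) (e := k)
    (fun s ↦ layerConjEnd_sub_one_pow_apply_eq_zero p κ₁ κ₂ θ 𝔣 n k hi γ₁ s)
    (fun s ↦ layerConjEnd_sub_one_pow_apply_eq_zero p κ₁ κ₂ θ 𝔣 n k hi γ₂ s)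
    (fun s ↦ levelCoh_torsion p (suppPF p 𝔣) θ (isOpen_pairLayerSubgroup κ₁ κ₂ n) k i s) τ
    (fun x ↦ by rw [h₁]; rfl) (fun x ↦ by rw [h₂]; rfl) (fun c x ↦ by rw [h₃, natCast_zsmul]) F x

end LevelLinear

namespace IwasawaCohomologyData

variable {K : Type} [Field K] [NumberField K] {p : ℕ} [Fact p.Prime]
  {κ₁ κ₂ : ZpExtension K p} {γ₁ γ₂ : absoluteGaloisGroup K}
  {θ : absoluteGaloisGroup K →ₜ* ℤ_[p]ˣ} {𝔣 : Ideal (𝓞 K)} {i : ℕ}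
  (I : IwasawaCohomologyData p κ₁ κ₂ γ₁ γ₂ θ 𝔣 i)

/-- **THE PINS (P5)–(P7) DETERMINE THE `Λ₂`-ACTION ON THE PINNED CARRIER** (`i ≤ 2`): for EVERY
`F ∈ Λ₂ = ℤ_p⟦T₂⟧⟦T₁⟧`, `proj n k (F • x) = F • proj n k x`, the right-hand side in the layer's own
`Λ₂`-structure `T_i ↦ conj_{γ_i} − 1` (`IsLocNil₂.selfModule` of `isLocNil₂_layerConjEnd`) — JLK §4.2 "the
`Λ_𝒪`-module structure on `H^i(𝒪_K[1/p], Λ(η))` is induced by" the Galois action, read levelwise; Lang: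
`Λ` acts on `lim←` through the finite quotients. In particular (P8) follows from (P5)–(P7).
[cite: JohnsonLeungKings2011, §4.2 Def. 4.2 (94) (arXiv p0012:L94, L109–112)] [cite: Lang1990, Ch. 5 §1 (Thm. 1.1)] -/
theorem proj_smul (hi : i ≤ 2) (n k : ℕ) (F : IwasawaAlgebra₂ p) (x : I.H) :
    I.proj n k (F • x) =
      (letI := (isLocNil₂_layerConjEnd p κ₁ κ₂ γ₁ γ₂ θ 𝔣 n k hi).selfModule; F • I.proj n k x) :=
  map_smul_of_pins p κ₁ κ₂ γ₁ γ₂ θ 𝔣 n k hi (I.proj n k) (I.proj_T₁_smul n k) (I.proj_T₂_smul n k)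
    (fun c x ↦ I.proj_C_smul c n k x) F x

/-- `(1 + T₁)^m` acts on the layer `(n, k)` as conjugation by the group element `γ₁^m` ((P5) iterated;
the operator-power form `(conj_{γ₁})^m` is `proj_one_add_X_pow_smul` of `…CarriersGroupElt.lean`).
[cite: JohnsonLeungKings2011, §4.2 (arXiv p0012:L109–112)] -/
theorem proj_one_add_X_pow_smul_eq_layerConj (n k m : ℕ) (x : I.H) :
    I.proj n k ((1 + (PowerSeries.X : IwasawaAlgebra₂ p)) ^ m • x) =
      layerConj p κ₁ κ₂ θ 𝔣 n k i (γ₁ ^ m) (I.proj n k x) := by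
  induction m generalizing x with
  | zero =>
    rw [pow_zero, one_smul, pow_zero]
    exact (levelConj_one p (suppPF p 𝔣) θ k i (I.proj n k x)).symm
  | succ m ih =>
    rw [pow_succ, mul_smul, ih, add_smul, one_smul, map_add, I.proj_T₁_smul, add_sub_cancel, pow_succ]
    exact levelConj_levelConj p (suppPF p 𝔣) θ k i (γ₁ ^ m) γ₁ (I.proj n k x)

/-- `(1 + T₂)^m` acts on the layer `(n, k)` as conjugation by the group element `γ₂^m` ((P6) iterated).
[cite: JohnsonLeungKings2011, §4.2 (arXiv p0012:L109–112)] -/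
theorem proj_one_add_C_X_pow_smul_eq_layerConj (n k m : ℕ) (x : I.H) :
    I.proj n k ((1 + (PowerSeries.C (PowerSeries.X : IwasawaAlgebra p) : IwasawaAlgebra₂ p)) ^ m • x) =
      layerConj p κ₁ κ₂ θ 𝔣 n k i (γ₂ ^ m) (I.proj n k x) := by
  induction m generalizing x with
  | zero =>
    rw [pow_zero, one_smul, pow_zero]
    exact (levelConj_one p (suppPF p 𝔣) θ k i (I.proj n k x)).symm
  | succ m ih =>
    rw [pow_succ, mul_smul, ih, add_smul, one_smul, map_add, I.proj_T₂_smul, add_sub_cancel, pow_succ]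
    exact levelConj_levelConj p (suppPF p 𝔣) θ k i (γ₂ ^ m) γ₂ (I.proj n k x)

/-- **`(1 + T₁)^{pⁿ}` acts trivially on the layer `(n, k)`**, `i ≤ 2` (`γ₁^{pⁿ} ∈ Gal(K̄/K̃_n)`): the level
relation `(1+T₁)^{pⁿ} − 1 ∈ Ann(H/ker proj_{n,k})`. [cite: Lang1990, Ch. 5 §1 (Thm. 1.1)] [cite: JohnsonLeungKings2011, §4.1–4.2 (arXiv p0012:L7–14, L109–112)] -/
theorem proj_one_add_X_pow_prime_pow_smul (hi : i ≤ 2) (n k : ℕ) (x : I.H) :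
    I.proj n k ((1 + (PowerSeries.X : IwasawaAlgebra₂ p)) ^ p ^ n • x) = I.proj n k x := by
  rw [I.proj_one_add_X_pow_smul_eq_layerConj]
  exact levelConj_eq_self_of_mem p (suppPF p 𝔣) θ (pow_mem_pairLayerSubgroup κ₁ κ₂ γ₁ n)
    (isOpen_pairLayerSubgroup κ₁ κ₂ n) k hi _

/-- **`(1 + T₂)^{pⁿ}` acts trivially on the layer `(n, k)`**, `i ≤ 2`. [cite: Lang1990, Ch. 5 §1 (Thm. 1.1)] [cite: JohnsonLeungKings2011, §4.1–4.2 (arXiv p0012:L7–14, L109–112)] -/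
theorem proj_one_add_C_X_pow_prime_pow_smul (hi : i ≤ 2) (n k : ℕ) (x : I.H) :
    I.proj n k ((1 + (PowerSeries.C (PowerSeries.X : IwasawaAlgebra p) : IwasawaAlgebra₂ p)) ^ p ^ n • x) =
      I.proj n k x := by
  rw [I.proj_one_add_C_X_pow_smul_eq_layerConj]
  exact levelConj_eq_self_of_mem p (suppPF p 𝔣) θ (pow_mem_pairLayerSubgroup κ₁ κ₂ γ₂ n)
    (isOpen_pairLayerSubgroup κ₁ κ₂ n) k hi _

/-- **`p^k` acts trivially on the layer `(n, k)`** (uniform `p^k`-torsion of the level groups).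
[cite: Kato2004Asterisque, §8.2 (p. 180)] -/
theorem proj_natCast_pow_smul (n k : ℕ) (x : I.H) :
    I.proj n k (((p ^ k : ℕ) : IwasawaAlgebra₂ p) • x) = 0 := by
  rw [Nat.cast_smul_eq_nsmul, map_nsmul]
  exact levelCoh_torsion p (suppPF p 𝔣) θ (isOpen_pairLayerSubgroup κ₁ κ₂ n) k i _

/-- **The level ideal `(p^k, (1+T₁)^{pⁿ} − 1, (1+T₂)^{pⁿ} − 1)` maps `H` into `ker (proj n k)`**, `i ≤ 2`:
`Λ₂` acts on `H / ker (proj n k) ↪ H^i(G_S(K̃_n), μ_{p^k} ⊗ θ)` through the finite group ring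
`(ℤ/p^k)[Gal(K̃_n/K)]` (Lang's `Λ = lim 𝔬[X]/((1+X)^{pⁿ} − 1)`, two variables).
[cite: Lang1990, Ch. 5 §1 (Thm. 1.1)] [cite: JohnsonLeungKings2011, §4.1 Def. 4.1 and §4.2 (arXiv p0012:L30–47, L109–112)] -/
theorem proj_smul_eq_zero_of_mem_span (hi : i ≤ 2) (n k : ℕ) {F : IwasawaAlgebra₂ p}
    (hF : F ∈ Ideal.span ({((p ^ k : ℕ) : IwasawaAlgebra₂ p),
      (1 + (PowerSeries.X : IwasawaAlgebra₂ p)) ^ p ^ n - 1,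
      (1 + (PowerSeries.C (PowerSeries.X : IwasawaAlgebra p) : IwasawaAlgebra₂ p)) ^ p ^ n - 1} :
        Set (IwasawaAlgebra₂ p)))
    (x : I.H) : I.proj n k (F • x) = 0 := by
  induction hF using Submodule.span_induction generalizing x with
  | mem G hG =>
    simp only [Set.mem_insert_iff, Set.mem_singleton_iff] at hG
    rcases hG with rfl | rfl | rfl
    · exact I.proj_natCast_pow_smul n k x
    · rw [sub_smul, one_smul, map_sub, I.proj_one_add_X_pow_prime_pow_smul hi, sub_self]
    · rw [sub_smul, one_smul, map_sub, I.proj_one_add_C_X_pow_prime_pow_smul hi, sub_self]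
  | zero => rw [zero_smul, map_zero]
  | add G G' _ _ hG hG' => rw [add_smul, map_add, hG, hG', add_zero]
  | smul r G _ hG => rw [smul_eq_mul, mul_smul]; exact I.proj_smul_eq_zero n k r _ (hG x)

/-! ## §3 The universal property: `Λ₂`-linear maps INTO the pinned carrier from level maps -/

section Lift

variable {X : Type*} [AddCommGroup X] [Module (IwasawaAlgebra₂ p) X]

omit [AddCommGroup X] [Module (IwasawaAlgebra₂ p) X] in
/-- **Maps into the pinned carrier are determined by their level components** ((P3)).
[cite: JohnsonLeungKings2011, Def. 4.2 (94) (arXiv p0012:L94)] -/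
theorem eq_of_forall_proj_eq {Φ Ψ : X → I.H} (h : ∀ (n k : ℕ) (x : X), I.proj n k (Φ x) = I.proj n k (Ψ x)) :
    Φ = Ψ :=
  funext fun x ↦ I.proj_eq_iff.mp fun n k ↦ h n k x

/-- **Lift of a compatible family of level-LINEAR maps** (`i ≤ 2`): additive `f n k : X →+ H^i(G_S(K̃_n), μ_{p^k} ⊗ θ)`
from a `Λ₂`-module `X`, compatible with the corestrictions and the reductions and `Λ₂`-linear for the layers'
own structures (`IsLocNil₂.selfModule` of `(conj_{γ₁} − 1, conj_{γ₂} − 1)`), glue to a `Λ₂`-LINEAR `Φ : X → H`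
with `proj n k (Φ x) = f n k x`: existence and additivity from (P3)–(P4), linearity from `proj_smul`.
[cite: JohnsonLeungKings2011, Def. 4.2 (94) (arXiv p0012:L94)] [cite: Lang1990, Ch. 5 §1 (Thm. 1.1)] -/
theorem exists_linearMap_of_levelMaps_of_smul (hi : i ≤ 2) (f : ∀ n k : ℕ, X →+ layerCoh p κ₁ κ₂ θ 𝔣 n k i)
    (hcores : ∀ (n k : ℕ) (x : X), layerCores p κ₁ κ₂ θ 𝔣 n k i (f (n + 1) k x) = f n k x)
    (hred : ∀ (n k : ℕ) (x : X), layerRed p κ₁ κ₂ θ 𝔣 n k i (f n (k + 1) x) = f n k x)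
    (hlin : ∀ (n k : ℕ) (F : IwasawaAlgebra₂ p) (x : X), f n k (F • x) =
      (letI := (isLocNil₂_layerConjEnd p κ₁ κ₂ γ₁ γ₂ θ 𝔣 n k hi).selfModule; F • f n k x)) :
    ∃ Φ : X →ₗ[IwasawaAlgebra₂ p] I.H, ∀ (n k : ℕ) (x : X), I.proj n k (Φ x) = f n k x := by
  have hfam : ∀ x : X, IsCompatibleFamily p κ₁ κ₂ θ 𝔣 i (fun n k ↦ f n k x) :=
    fun x ↦ ⟨fun n k ↦ hcores n k x, fun n k ↦ hred n k x⟩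
  choose g hg using fun x : X ↦ I.proj_surjective _ (hfam x)
  refine ⟨{ toFun := g, map_add' := fun x y ↦ ?_, map_smul' := fun F x ↦ ?_ }, fun n k x ↦ hg x n k⟩
  · exact I.proj_eq_iff.mp fun n k ↦ by rw [map_add, hg, hg, hg, map_add]
  · refine I.proj_eq_iff.mp fun n k ↦ ?_
    rw [RingHom.id_apply, I.proj_smul hi, hg, hg]
    exact hlin n k F x

/-- **THE UNIVERSAL PROPERTY of the pinned carrier `H^i(𝒪_K[1/p𝔣], Λ(χ)(1)) = lim←_{n,k} H^i(G_S(K̃_n), μ_{p^k} ⊗ θ)`**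
(`i ≤ 2`). Let `X` be ANY `Λ₂`-module and `f n k : X →+ H^i(G_S(K̃_n), μ_{p^k} ⊗ θ)` additive maps that are
(i) compatible with the corestrictions `cor_{K̃_{n+1}/K̃_n}` and (ii) with the reductions `μ_{p^{k+1}} → μ_{p^k}`,
and satisfy the three pin-shaped equations (iii) `f (T₁ • x) = γ₁·f x − f x`, (iv) `f (T₂ • x) = γ₂·f x − f x`,
(v) `f (c • x) = (c mod p^k) • f x` (`c ∈ ℤ_p`). Then there is a `Λ₂`-LINEAR `Φ : X → H` with
`proj n k (Φ x) = f n k x` for all `n, k` (unique by `eq_of_forall_proj_eq`). Additivity and EXISTENCE from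
(P3)–(P4) (a compatible family is an element); `Λ₂`-linearity because both `proj n k ∘ Φ ∘ (F •)` and
`proj n k ∘ (F •) ∘ Φ` equal `F • f n k` in the layer's structure (`proj_smul`, `map_smul_of_pins`).
This is how the norm- and reduction-compatible systems of arithmetic (Poitou–Tate duals of finite-level
Selmer groups, ROW 1; Kummer images of units, ROW 2) become `Λ`-linear maps into JLK's `H^i`.
[cite: JohnsonLeungKings2011, Def. 4.2 (94) and §5.2 ("`_𝔞ζ(χ) := lim←_n _𝔞ζ_{K_n}(χ)`") (arXiv p0012:L94, p0014:L80–90)] [cite: Kato2004Asterisque, §12.2 (12.2.1) (p. 220)] [cite: Lang1990, Ch. 5 §1 (Thm. 1.1)] -/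
theorem exists_linearMap_of_levelMaps (hi : i ≤ 2) (f : ∀ n k : ℕ, X →+ layerCoh p κ₁ κ₂ θ 𝔣 n k i)
    (hcores : ∀ (n k : ℕ) (x : X), layerCores p κ₁ κ₂ θ 𝔣 n k i (f (n + 1) k x) = f n k x)
    (hred : ∀ (n k : ℕ) (x : X), layerRed p κ₁ κ₂ θ 𝔣 n k i (f n (k + 1) x) = f n k x)
    (h₁ : ∀ (n k : ℕ) (x : X), f n k ((PowerSeries.X : IwasawaAlgebra₂ p) • x) =
      layerConj p κ₁ κ₂ θ 𝔣 n k i γ₁ (f n k x) - f n k x)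
    (h₂ : ∀ (n k : ℕ) (x : X),
      f n k ((PowerSeries.C (PowerSeries.X : IwasawaAlgebra p) : IwasawaAlgebra₂ p) • x) =
        layerConj p κ₁ κ₂ θ 𝔣 n k i γ₂ (f n k x) - f n k x)
    (h₃ : ∀ (c : ℤ_[p]) (n k : ℕ) (x : X),
      f n k ((PowerSeries.C (PowerSeries.C c : IwasawaAlgebra p) : IwasawaAlgebra₂ p) • x) =
        ((PadicInt.toZModPow k c).val : ℤ) • f n k x) :
    ∃ Φ : X →ₗ[IwasawaAlgebra₂ p] I.H, ∀ (n k : ℕ) (x : X), I.proj n k (Φ x) = f n k x :=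
  I.exists_linearMap_of_levelMaps_of_smul hi f hcores hred fun n k F x ↦
    map_smul_of_pins p κ₁ κ₂ γ₁ γ₂ θ 𝔣 n k hi (f n k) (h₁ n k) (h₂ n k) (fun c x ↦ h₃ c n k x) F x

/-- **Kernel of the lift**: `Φ x = 0 ↔ f n k x = 0` for all `n, k` ((P3)). [cite: JohnsonLeungKings2011, Def. 4.2 (94) (arXiv p0012:L94)] -/
theorem map_eq_zero_iff_of_proj_eq {Φ : X →ₗ[IwasawaAlgebra₂ p] I.H} {f : ∀ n k : ℕ, X →+ layerCoh p κ₁ κ₂ θ 𝔣 n k i}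
    (hΦ : ∀ (n k : ℕ) (x : X), I.proj n k (Φ x) = f n k x) (x : X) :
    Φ x = 0 ↔ ∀ n k : ℕ, f n k x = 0 := by
  refine ⟨fun h n k ↦ by rw [← hΦ, h, map_zero], fun h ↦ I.proj_injective _ fun n k ↦ ?_⟩
  rw [hΦ, h]

/-- **The lift is injective iff the level maps jointly detect every element.** [cite: JohnsonLeungKings2011, Def. 4.2 (94) (arXiv p0012:L94)] -/
theorem injective_iff_of_proj_eq {Φ : X →ₗ[IwasawaAlgebra₂ p] I.H} {f : ∀ n k : ℕ, X →+ layerCoh p κ₁ κ₂ θ 𝔣 n k i}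
    (hΦ : ∀ (n k : ℕ) (x : X), I.proj n k (Φ x) = f n k x) :
    Function.Injective Φ ↔ ∀ x : X, (∀ n k : ℕ, f n k x = 0) → x = 0 := by
  rw [injective_iff_map_eq_zero]
  exact forall_congr' fun x ↦ by rw [I.map_eq_zero_iff_of_proj_eq hΦ]

/-- **Range of the lift**: `y` is a value of `Φ` iff its level components are the `f n k x` of ONE `x`
((P3)). [cite: JohnsonLeungKings2011, Def. 4.2 (94) (arXiv p0012:L94)] -/
theorem mem_range_iff_of_proj_eq {Φ : X →ₗ[IwasawaAlgebra₂ p] I.H} {f : ∀ n k : ℕ, X →+ layerCoh p κ₁ κ₂ θ 𝔣 n k i}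
    (hΦ : ∀ (n k : ℕ) (x : X), I.proj n k (Φ x) = f n k x) (y : I.H) :
    y ∈ LinearMap.range Φ ↔ ∃ x : X, ∀ n k : ℕ, I.proj n k y = f n k x := by
  refine ⟨fun ⟨x, hx⟩ ↦ ⟨x, fun n k ↦ by rw [← hx, hΦ]⟩, fun ⟨x, hx⟩ ↦ ⟨x, ?_⟩⟩
  exact I.proj_eq_iff.mp fun n k ↦ by rw [hΦ, hx]

end Lift

/-! ## §4 Uniqueness of the pinned datum up to isomorphism -/

/-- **ANY TWO PINNED DATA ARE ISOMORPHIC, compatibly with all projections** (`i ≤ 2`): transcription note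
(T2) of the carriers file ("these pins DETERMINE the datum up to a unique isomorphism compatible with all
projections … so a `∀`-fact over the data is a statement about ONE object") as a theorem — the universal
property applied to the projections of each datum, which satisfy the other's hypotheses by its own pins
(P1), (P2), (P5)–(P7); the two lifts are mutually inverse by (P3). Uniqueness of the isomorphism is
`eq_of_forall_proj_eq`. [cite: JohnsonLeungKings2011, Def. 4.2 (94) (arXiv p0012:L94)] [cite: Kato2004Asterisque, §12.2 (12.2.1) (p. 220)] -/
theorem exists_linearEquiv_proj_eq (hi : i ≤ 2) (I' : IwasawaCohomologyData p κ₁ κ₂ γ₁ γ₂ θ 𝔣 i) :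
    ∃ e : I.H ≃ₗ[IwasawaAlgebra₂ p] I'.H, ∀ (n k : ℕ) (x : I.H), I'.proj n k (e x) = I.proj n k x := by
  obtain ⟨Φ, hΦ⟩ := I'.exists_linearMap_of_levelMaps hi I.proj I.proj_cores I.proj_red I.proj_T₁_smul
    I.proj_T₂_smul (fun c n k x ↦ I.proj_C_smul c n k x)
  obtain ⟨Ψ, hΨ⟩ := I.exists_linearMap_of_levelMaps hi I'.proj I'.proj_cores I'.proj_red I'.proj_T₁_smul
    I'.proj_T₂_smul (fun c n k x ↦ I'.proj_C_smul c n k x)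
  refine ⟨{ Φ with
    invFun := Ψ
    left_inv := fun x ↦ I.proj_eq_iff.mp fun n k ↦ by rw [LinearMap.toFun_eq_coe, hΨ, hΦ]
    right_inv := fun y ↦ I'.proj_eq_iff.mp fun n k ↦ by rw [LinearMap.toFun_eq_coe, hΦ, hΨ] }, hΦ⟩

end IwasawaCohomologyData

end Literature.NumberTheory.ComplexMultiplication.EllipticUnits.JohnsonLeungKings2011

end
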